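import Summits.ResolutionOfSingularities.ResolutionOfSingularities.Theorems.FrobeniusLadderFInjectiveMacaulayficationE4GermSpecimen
import Summits.ResolutionOfSingularities.ResolutionOfSingularities.Theorems.FrobeniusLadderFInjectiveMacaulayficationFCentreE1ChartPresentation
import Summits.ResolutionOfSingularities.ResolutionOfSingularities.Theorems.FrobeniusLadderFInjectiveMacaulayficationFTemkinClosedPoints
import Summits.ResolutionOfSingularities.ResolutionOfSingularities.Theorems.FrobeniusLadderFInjectiveMacaulayficationRegularBlowupModelDim2
import Literature.AlgebraicGeometry.Resolution.AffineBlowupUnique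
import Literature.AlgebraicGeometry.Resolution.AffineBlowupIntegral
import HarnessLib

/-!
# E4″@G (F1): THE POINT BLOW-UP `Bl_𝔪 G` OF `G = {ab + w₁³ + w₂³ + w₃³ = 0}` IS FULL AT EVERY POINT (char 2, any field) — floor 1 of the T″(2,4,·) instance
# (crux `FInjectiveMacaulayfication` stmt-ResolutionOfSingularities-15315, chain w45a; res-L1-w45a-plan-1 RULINGS R18.20 / R18.22 (1) / R18.26 (2) «(F1) GO»;
# res-L1-w45a-stub-3's typing plan `g9/E4-STEP-TYPING.md` §B (F1); engine = res-L1-w45a-stub-1's `GermOfGlobalBlowup.hypersurfacePointBlowup_fullCl` (p599230);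
# seat res-L1-w45a-stub-2 g8)

[OURS · L1 W4.5a] Support file (`--supports stmt-ResolutionOfSingularities-15315 --as helper`); unconditional; replaces the role of NO printed item; NOT a statement of the
manuscript; AI-written (AI review is weaker than expert review).

`G = Spec k[X₀..X₄]/(f)`, `f = X₀X₁ + X₂³ + X₃³ + X₄³` (`a, b, w₁, w₂, w₃`; specimen package `E4GermSpecimen`), `char k = 2`, `𝔪 = (x̄₀, …, x̄₄)` the vertex. The point blow-up
`X₁ := affineBlowup 𝔪` (the tree's `Proj` of the Rees algebra) has five charts with strict transforms (`θ_i : X_j ↦ X_jX_i (j ≠ i)`, `θ_i f = X_i² · g_i`, `μ = 2`):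
`g₀ = X₁ + X₀(X₂³+X₃³+X₄³)`, `g₁ = X₀ + X₁(X₂³+X₃³+X₄³)` (regular: a linear term), `g_i = X₀X₁ + X_i(1 + Σ_{j ∉ {0,1,i}} X_j³)` (`i = 2,3,4`; the cA-family
`a′b′ = w_i·(1+U³+V³)` of `g9/E4-STEP.md` §2, singular exactly along the smooth cubic curve `E`). EVERY chart is F-pure at EVERY point by ONE thin Fedder cell (the
square-free terms `X₁`, `X₀`, `X₀X₁` have constant class coefficient `1`; `hcheck_*` by `decide +kernel`) and CM (hypersurface), so the engine gives:
* ★★ `affineBlowup_vertex_fullCl` — `∀ y : affineBlowup 𝔪, FullCl 2 (stalk y)`;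
* `support_idealSheaf_vertex` — `supp 𝔪̃ = {v}`; ★ `forall_isBlowup_vertex_fullCl` — `𝔪̃ ≠ ⊥ ∧` EVERY blowing up of `G` along `𝔪̃` is FULL at every point (`IsBlowup.unique`).
So `S′ = Bl_𝔪 G` is a LEGAL INPUT of the T″ step (FULL everywhere; regular off the fibre since `G` is regular off `v`, `E4GermSpecimen.regular_of_ne_vertex`); its singular
locus `E` and the regularity of `Bl_E S′` are (F2)/(F3) (T-side, res-L1-w45a-stub-3's next generation). Tables `G0L … G4L`, `CELL0 … CELL4` are plain data (no instances,
no notation); no named facts. [folklore mathematics, OURS as a certificate; cite: Fedder1983, Prop. 1.7 and Thm. 1.12; StacksProject, Tag 0804; GortzWedhorn2020, Prop. 13.92]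
-/

-- single-problem summit: the doubled namespace component is forced
set_option linter.dupNamespace false

noncomputable section

open AlgebraicGeometry CategoryTheory Literature.AlgebraicGeometry.Resolution TopologicalSpace IsLocalRing MvPolynomial

namespace Summit.ResolutionOfSingularities.ResolutionOfSingularities.Theorems.FInjectiveMacaulayfication.E4GermPointBlowupFull

open Summit.ResolutionOfSingularities.ResolutionOfSingularities.Theorems.FInjectiveMacaulayfication
open SliceableCentre GermOfGlobalBlowup E4GermSpecimen

/-! ## §1 The five strict transforms as term lists, their thin Fedder cells, the kernel checks -/

/-- `g₀ = X₁ + X₀X₂³ + X₀X₃³ + X₀X₄³`. -/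
def G0L : List (ℤ × (Fin 5 → ℕ)) :=
  [((1 : ℤ), ![0, 1, 0, 0, 0]), ((1 : ℤ), ![1, 0, 3, 0, 0]), ((1 : ℤ), ![1, 0, 0, 3, 0]), ((1 : ℤ), ![1, 0, 0, 0, 3])]

/-- `g₁ = X₀ + X₁X₂³ + X₁X₃³ + X₁X₄³`. -/
def G1L : List (ℤ × (Fin 5 → ℕ)) :=
  [((1 : ℤ), ![1, 0, 0, 0, 0]), ((1 : ℤ), ![0, 1, 3, 0, 0]), ((1 : ℤ), ![0, 1, 0, 3, 0]), ((1 : ℤ), ![0, 1, 0, 0, 3])]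

/-- `g₂ = X₀X₁ + X₂ + X₂X₃³ + X₂X₄³`. -/
def G2L : List (ℤ × (Fin 5 → ℕ)) :=
  [((1 : ℤ), ![1, 1, 0, 0, 0]), ((1 : ℤ), ![0, 0, 1, 0, 0]), ((1 : ℤ), ![0, 0, 1, 3, 0]), ((1 : ℤ), ![0, 0, 1, 0, 3])]

/-- `g₃ = X₀X₁ + X₃ + X₃X₂³ + X₃X₄³`. -/
def G3L : List (ℤ × (Fin 5 → ℕ)) :=
  [((1 : ℤ), ![1, 1, 0, 0, 0]), ((1 : ℤ), ![0, 0, 0, 1, 0]), ((1 : ℤ), ![0, 0, 3, 1, 0]), ((1 : ℤ), ![0, 0, 0, 1, 3])]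

/-- `g₄ = X₀X₁ + X₄ + X₄X₂³ + X₄X₃³`. -/
def G4L : List (ℤ × (Fin 5 → ℕ)) :=
  [((1 : ℤ), ![1, 1, 0, 0, 0]), ((1 : ℤ), ![0, 0, 0, 0, 1]), ((1 : ℤ), ![0, 0, 3, 0, 1]), ((1 : ℤ), ![0, 0, 0, 3, 1])]

/-- Thin cell of `g₀`: class `e₁` (the term `X₁`), coefficient `1`. -/
def CELL0 : List (Finset (Fin 5) × List ((Fin 5 → ℕ) × List (ℤ × (Fin 5 → ℕ))) × (Fin 5 → List (ℤ × (Fin 5 → ℕ))) × List (ℤ × (Fin 5 → ℕ))) :=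
  [((∅ : Finset (Fin 5)), [(![0, 1, 0, 0, 0], [((1 : ℤ), ![0, 0, 0, 0, 0])])], (fun _ => []), [])]

/-- Thin cell of `g₁`: class `e₀` (the term `X₀`), coefficient `1`. -/
def CELL1 : List (Finset (Fin 5) × List ((Fin 5 → ℕ) × List (ℤ × (Fin 5 → ℕ))) × (Fin 5 → List (ℤ × (Fin 5 → ℕ))) × List (ℤ × (Fin 5 → ℕ))) :=
  [((∅ : Finset (Fin 5)), [(![1, 0, 0, 0, 0], [((1 : ℤ), ![0, 0, 0, 0, 0])])], (fun _ => []), [])]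

/-- Thin cell of `g₂, g₃, g₄`: class `e₀ + e₁` (the term `X₀X₁`), coefficient `1`. -/
def CELL234 : List (Finset (Fin 5) × List ((Fin 5 → ℕ) × List (ℤ × (Fin 5 → ℕ))) × (Fin 5 → List (ℤ × (Fin 5 → ℕ))) × List (ℤ × (Fin 5 → ℕ))) :=
  [((∅ : Finset (Fin 5)), [(![1, 1, 0, 0, 0], [((1 : ℤ), ![0, 0, 0, 0, 0])])], (fun _ => []), [])]

/-- ★ The Fedder certificates of the five charts (one kernel `decide` each). -/
theorem hcheck_all : KLocCellKit.checkKs 2 G0L CELL0 = true ∧ KLocCellKit.checkKs 2 G1L CELL1 = true ∧ KLocCellKit.checkKs 2 G2L CELL234 = true ∧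
    KLocCellKit.checkKs 2 G3L CELL234 = true ∧ KLocCellKit.checkKs 2 G4L CELL234 = true := by
  refine ⟨?_, ?_, ?_, ?_, ?_⟩ <;> decide +kernel

/-- For every chart and variable, a term free of that variable with odd coefficient class (so no variable divides `g_c`). -/
theorem hX_raw_all : ∀ L ∈ [G0L, G1L, G2L, G3L, G4L], ∀ i : Fin 5, ∃ t ∈ L, t.2 i = 0 ∧
    ¬ ((2 : ℤ) ∣ ((L.filter fun s : ℤ × (Fin 5 → ℕ) => s.2 = t.2).map fun s : ℤ × (Fin 5 → ℕ) => s.1).sum) := by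
  decide +kernel

/-! ## §2 The clause at every maximal ideal of a chart ring from a thin cell (generic over the term list) -/

/-- **Thin cell ⇒ CM + Frobenius-closed clause at EVERY maximal ideal of `k[X]/(g)`**, `g = evalL L` (`KLocCellRange.honQuot_of_kLocCells_range` at `V = 1`, `J = ∅`).
[cite: Fedder1983, Prop. 1.7 and Thm. 1.12] -/
theorem clause_of_thinCell (k : Type) [Field k] [CharP k 2] (L : List (ℤ × (Fin 5 → ℕ)))
    (cells : List (Finset (Fin 5) × List ((Fin 5 → ℕ) × List (ℤ × (Fin 5 → ℕ))) × (Fin 5 → List (ℤ × (Fin 5 → ℕ))) × List (ℤ × (Fin 5 → ℕ))))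
    (hcheck : KLocCellKit.checkKs 2 L cells = true) (hS : (∅ : Finset (Fin 5)) ∈ cells.map Prod.fst)
    (hXraw : ∀ i : Fin 5, ∃ t ∈ L, t.2 i = 0 ∧ ¬ ((2 : ℤ) ∣ ((L.filter fun s : ℤ × (Fin 5 → ℕ) => s.2 = t.2).map fun s : ℤ × (Fin 5 → ℕ) => s.1).sum))
    (g : MvPolynomial (Fin 5) k) (hg : g = KLocCellKit.evalL k L)
    (Q : Ideal (MvPolynomial (Fin 5) k ⧸ Ideal.span {g})) [Q.IsMaximal] :
    ∀ d : ℕ, ringKrullDim (Localization.AtPrime Q) = d → ∀ s : Fin d → Localization.AtPrime Q,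
      (Ideal.span (Set.range s)).radical.IsMaximal →
        RingTheory.Sequence.IsWeaklyRegular (Localization.AtPrime Q) (List.ofFn s) ∧
        ∀ y : Localization.AtPrime Q, (∃ e : ℕ, y ^ 2 ^ e ∈ Ideal.span
          ((fun z : Localization.AtPrime Q => z ^ 2 ^ e) ''
            (Ideal.span (Set.range s) : Set (Localization.AtPrime Q)))) → y ∈ Ideal.span (Set.range s) := by
  haveI : Fact (Nat.Prime 2) := ⟨Nat.prime_two⟩
  have hX : ∀ i : Fin 5, ¬ (X i ∣ KLocCellKit.evalL k L) := by
    unfold KLocCellKit.evalL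
    exact NotDvdOfSupport.forall_not_X_dvd_evalL 2 L hXraw
  have hg0 : KLocCellKit.evalL k L ≠ 0 := fun h => hX 0 (by rw [h]; exact dvd_zero _)
  have hI : Ideal.span (Set.range (![KLocCellKit.evalL k L] : Fin 1 → MvPolynomial (Fin 5) k)) = Ideal.span {g} := by
    rw [LevelTwoBlockTranslate.range_vec_one, ← hg]
  let e : (MvPolynomial (Fin 5) k ⧸ Ideal.span (Set.range (![KLocCellKit.evalL k L] : Fin 1 → MvPolynomial (Fin 5) k))) ≃+*
      (MvPolynomial (Fin 5) k ⧸ Ideal.span {g}) := Ideal.quotEquivOfEq hI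
  have hon := KLocCellRange.honQuot_of_kLocCells_range 2 k 5 (∅ : Finset (Fin 5)) (1 : Matrix (Fin 5) (Fin 5) ℕ)
    (![KLocCellKit.evalL k L] : Fin 1 → MvPolynomial (Fin 5) k) hg0 hX (cells.map Prod.fst)
    (fun T _ => ⟨∅, hS, Finset.empty_subset T⟩)
    (KLocCellKit.klocCells_of_check k 2 L cells hcheck)
  exact E8Char5FiModel.clause_maximal_of_ringEquiv 2 e (e.symm 0) 0 (e.apply_symm_apply 0)
    (fun Q' hQ' _ => by haveI := hQ'; exact (hon Q' (fun j hj => absurd hj (Finset.notMem_empty j))).2) Q Q.zero_mem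

/-! ## §3 The strict transforms: values, charts identities, non-divisibility -/

/-- The strict transforms as polynomials equal the values of the term lists. -/
theorem g_eq_evalL (k : Type) [Field k] :
    (X 1 + X 0 * (X 2 ^ 3 + X 3 ^ 3 + X 4 ^ 3) : MvPolynomial (Fin 5) k) = KLocCellKit.evalL k G0L ∧
    (X 0 + X 1 * (X 2 ^ 3 + X 3 ^ 3 + X 4 ^ 3) : MvPolynomial (Fin 5) k) = KLocCellKit.evalL k G1L ∧
    (X 0 * X 1 + X 2 * (1 + X 3 ^ 3 + X 4 ^ 3) : MvPolynomial (Fin 5) k) = KLocCellKit.evalL k G2L ∧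
    (X 0 * X 1 + X 3 * (1 + X 2 ^ 3 + X 4 ^ 3) : MvPolynomial (Fin 5) k) = KLocCellKit.evalL k G3L ∧
    (X 0 * X 1 + X 4 * (1 + X 2 ^ 3 + X 3 ^ 3) : MvPolynomial (Fin 5) k) = KLocCellKit.evalL k G4L := by
  simp only [KLocCellKit.evalL, G0L, G1L, G2L, G3L, G4L, List.map_cons, List.map_nil, List.sum_cons, List.sum_nil, Int.cast_one,
    PConeFedderData.monomial_five]
  refine ⟨?_, ?_, ?_, ?_, ?_⟩ <;> ring

/-- ★ **The chart identities** `θ_i f = X_i² · g_i` for the point blow-up substitutions `θ_i : X_j ↦ X_jX_i (j ≠ i), X_i ↦ X_i`. [folklore] -/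
theorem theta (k : Type) [Field k] (f : MvPolynomial (Fin 5) k) (hf : f = X 0 * X 1 + X 2 ^ 3 + X 3 ^ 3 + X 4 ^ 3) :
    ∀ i : Fin 5, aeval (fun j : Fin 5 => if j = i then (X i : MvPolynomial (Fin 5) k) else X j * X i) f =
      X i ^ 2 * (![X 1 + X 0 * (X 2 ^ 3 + X 3 ^ 3 + X 4 ^ 3), X 0 + X 1 * (X 2 ^ 3 + X 3 ^ 3 + X 4 ^ 3),
        X 0 * X 1 + X 2 * (1 + X 3 ^ 3 + X 4 ^ 3), X 0 * X 1 + X 3 * (1 + X 2 ^ 3 + X 4 ^ 3),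
        X 0 * X 1 + X 4 * (1 + X 2 ^ 3 + X 3 ^ 3)] : Fin 5 → MvPolynomial (Fin 5) k) i := by
  intro i
  subst hf
  fin_cases i <;> simp <;> ring

/-- `f ∉ (X_i)` for every `i` (no variable divides `f`). [folklore] -/
theorem f_not_mem_span_X (k : Type) [Field k] [CharP k 2] (f : MvPolynomial (Fin 5) k) (hf : f = X 0 * X 1 + X 2 ^ 3 + X 3 ^ 3 + X 4 ^ 3) :
    ∀ i : Fin 5, f ∉ Ideal.span {(X i : MvPolynomial (Fin 5) k)} := by
  intro i h
  rw [Ideal.mem_span_singleton] at h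
  exact E4GermSpecimen.hX k i (E4GermSpecimen.f_eq_evalL k f hf ▸ h)

/-- `g_i ∉ (X_i)` for every `i` (indeed no variable divides any `g_i`). [folklore] -/
theorem g_not_mem_span_X (k : Type) [Field k] [CharP k 2] :
    ∀ i : Fin 5, (![X 1 + X 0 * (X 2 ^ 3 + X 3 ^ 3 + X 4 ^ 3), X 0 + X 1 * (X 2 ^ 3 + X 3 ^ 3 + X 4 ^ 3),
        X 0 * X 1 + X 2 * (1 + X 3 ^ 3 + X 4 ^ 3), X 0 * X 1 + X 3 * (1 + X 2 ^ 3 + X 4 ^ 3),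
        X 0 * X 1 + X 4 * (1 + X 2 ^ 3 + X 3 ^ 3)] : Fin 5 → MvPolynomial (Fin 5) k) i ∉
      Ideal.span {(X i : MvPolynomial (Fin 5) k)} := by
  obtain ⟨e0, e1, e2, e3, e4⟩ := g_eq_evalL k
  have h := hX_raw_all
  intro i hi
  rw [Ideal.mem_span_singleton] at hi
  fin_cases i
  · exact NotDvdOfSupport.forall_not_X_dvd_evalL (K := k) 2 G0L (h G0L (by simp)) 0 (by simpa [e0, KLocCellKit.evalL] using hi)
  · exact NotDvdOfSupport.forall_not_X_dvd_evalL (K := k) 2 G1L (h G1L (by simp)) 1 (by simpa [e1, KLocCellKit.evalL] using hi)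
  · exact NotDvdOfSupport.forall_not_X_dvd_evalL (K := k) 2 G2L (h G2L (by simp)) 2 (by simpa [e2, KLocCellKit.evalL] using hi)
  · exact NotDvdOfSupport.forall_not_X_dvd_evalL (K := k) 2 G3L (h G3L (by simp)) 3 (by simpa [e3, KLocCellKit.evalL] using hi)
  · exact NotDvdOfSupport.forall_not_X_dvd_evalL (K := k) 2 G4L (h G4L (by simp)) 4 (by simpa [e4, KLocCellKit.evalL] using hi)

/-! ## §4 ★★ `Bl_𝔪 G` is FULL at every point -/

/-- ★★ **THE POINT BLOW-UP `affineBlowup 𝔪` OF `G = {ab + w₁³+w₂³+w₃³}` IS FULL AT EVERY POINT** (char 2, any field): the engine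
`GermOfGlobalBlowup.hypersurfacePointBlowup_fullCl` with `μ = 2`, the five strict transforms, `E4GermSpecimen.regular_off_vertex` off the exceptional divisor, and on
each chart the CM + Frobenius-closed clause at EVERY maximal ideal from one thin Fedder cell (§1–§2). [OURS · certificate; cite: Fedder1983, Thm. 1.12; StacksProject, Tag 0804] -/
theorem affineBlowup_vertex_fullCl (k : Type) [Field k] [CharP k 2] (f : MvPolynomial (Fin 5) k)
    (hf : f = X 0 * X 1 + X 2 ^ 3 + X 3 ^ 3 + X 4 ^ 3) :
    ∀ y : ↥(affineBlowup (Ideal.span (Set.range fun j : Fin 5 => Ideal.Quotient.mk (Ideal.span {f}) (X j)))),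
      FullCl 2 ((affineBlowup (Ideal.span (Set.range fun j : Fin 5 =>
        Ideal.Quotient.mk (Ideal.span {f}) (X j)))).presheaf.stalk y) := by
  haveI : Fact (Nat.Prime 2) := ⟨Nat.prime_two⟩
  have hprime := prime_f k f hf
  obtain ⟨e0, e1, e2, e3, e4⟩ := g_eq_evalL k
  obtain ⟨c0, c1, c2, c3, c4⟩ := hcheck_all
  have hXr := hX_raw_all
  refine hypersurfacePointBlowup_fullCl 2 k 5 (by omega) f
    (![X 1 + X 0 * (X 2 ^ 3 + X 3 ^ 3 + X 4 ^ 3), X 0 + X 1 * (X 2 ^ 3 + X 3 ^ 3 + X 4 ^ 3),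
        X 0 * X 1 + X 2 * (1 + X 3 ^ 3 + X 4 ^ 3), X 0 * X 1 + X 3 * (1 + X 2 ^ 3 + X 4 ^ 3),
        X 0 * X 1 + X 4 * (1 + X 2 ^ 3 + X 3 ^ 3)] : Fin 5 → MvPolynomial (Fin 5) k)
    2 ((Ideal.span_singleton_prime hprime.ne_zero).mpr hprime) (theta k f hf) (f_not_mem_span_X k f hf) (g_not_mem_span_X k)
    (fun P _ hP => regular_off_vertex k f hf P hP) ?_
  intro i
  fin_cases i
  · intro Q hQ _
    exact @clause_of_thinCell k _ _ G0L CELL0 c0 (by decide) (hXr G0L (by simp)) _ e0 Q hQ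
  · intro Q hQ _
    exact @clause_of_thinCell k _ _ G1L CELL1 c1 (by decide) (hXr G1L (by simp)) _ e1 Q hQ
  · intro Q hQ _
    exact @clause_of_thinCell k _ _ G2L CELL234 c2 (by decide) (hXr G2L (by simp)) _ e2 Q hQ
  · intro Q hQ _
    exact @clause_of_thinCell k _ _ G3L CELL234 c3 (by decide) (hXr G3L (by simp)) _ e3 Q hQ
  · intro Q hQ _
    exact @clause_of_thinCell k _ _ G4L CELL234 c4 (by decide) (hXr G4L (by simp)) _ e4 Q hQ

/-- **The support of the centre `𝔪̃` is the vertex.** [folklore; cite: StacksProject, Tag 0804] -/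
theorem support_idealSheaf_vertex (k : Type) [Field k] (f : MvPolynomial (Fin 5) k)
    (hf : f = X 0 * X 1 + X 2 ^ 3 + X 3 ^ 3 + X 4 ^ 3)
    (v : Spec (.of (MvPolynomial (Fin 5) k ⧸ Ideal.span {f})))
    (hv : v.asIdeal = Ideal.span (Set.range fun j : Fin 5 => Ideal.Quotient.mk (Ideal.span {f}) (X j))) :
    ((affineBlowup.idealSheaf (Ideal.span (Set.range fun j : Fin 5 => Ideal.Quotient.mk (Ideal.span {f}) (X j)))).support :
      Set (Spec (.of (MvPolynomial (Fin 5) k ⧸ Ideal.span {f})))) = {v} := by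
  have hmax : v.asIdeal.IsMaximal := by
    rw [hv]; exact DoublePointFermatCubicGerm.isMaximal_origin k f (constantCoeff_f k f hf)
  rw [affineBlowup.support_idealSheaf]
  ext w
  change ((Ideal.span (Set.range fun j : Fin 5 => Ideal.Quotient.mk (Ideal.span {f}) (X j)) :
      Ideal (MvPolynomial (Fin 5) k ⧸ Ideal.span {f})) : Set (MvPolynomial (Fin 5) k ⧸ Ideal.span {f})) ⊆
      (w.asIdeal : Set (MvPolynomial (Fin 5) k ⧸ Ideal.span {f})) ↔ w = v
  rw [SetLike.coe_subset_coe, ← hv]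
  constructor
  · intro h
    exact PrimeSpectrum.ext (hmax.eq_of_le w.isPrime.ne_top h).symm
  · rintro rfl
    exact le_rfl

/-- ★ **`𝔪̃ ≠ ⊥`, AND EVERY BLOWING UP OF `G` ALONG `𝔪̃` IS FULL AT EVERY POINT** (`IsBlowup.unique`; FULL moves along isomorphic stalks).
[OURS · certificate; cite: GortzWedhorn2020, Prop. 13.92] -/
theorem forall_isBlowup_vertex_fullCl (k : Type) [Field k] [CharP k 2] (f : MvPolynomial (Fin 5) k)
    (hf : f = X 0 * X 1 + X 2 ^ 3 + X 3 ^ 3 + X 4 ^ 3) :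
    affineBlowup.idealSheaf (Ideal.span (Set.range fun j : Fin 5 => Ideal.Quotient.mk (Ideal.span {f}) (X j))) ≠ ⊥ ∧
    ∀ (X' : Scheme.{0}) (π : X' ⟶ Spec (.of (MvPolynomial (Fin 5) k ⧸ Ideal.span {f}))),
      IsBlowup π (affineBlowup.idealSheaf (Ideal.span (Set.range fun j : Fin 5 => Ideal.Quotient.mk (Ideal.span {f}) (X j)))) →
      ∀ x' : X', FullCl 2 (X'.presheaf.stalk x') := by
  haveI hfprime : (Ideal.span {f}).IsPrime := (Ideal.span_singleton_prime (prime_f k f hf).ne_zero).mpr (prime_f k f hf)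
  haveI : IsDomain (MvPolynomial (Fin 5) k ⧸ Ideal.span {f}) := Ideal.Quotient.isDomain _
  have hIne : Ideal.span (Set.range fun j : Fin 5 => Ideal.Quotient.mk (Ideal.span {f}) (X j)) ≠ ⊥ := by
    intro h0
    have hmem : Ideal.Quotient.mk (Ideal.span {f}) (X 2) ∈ Ideal.span (Set.range fun j : Fin 5 => Ideal.Quotient.mk (Ideal.span {f}) (X j)) :=
      Ideal.subset_span ⟨2, rfl⟩
    rw [h0, Ideal.mem_bot] at hmem
    exact FCentreE1ChartPresentation.mk_X_ne_zero_of_eval k f hfprime 2 (Pi.single 3 1) (by simp) (by rw [hf]; simp) hmem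
  haveI := affineBlowup.isIntegral hIne
  refine ⟨RegularBlowupModelDim2.ne_bot_of_isBlowup (affineBlowup.isBlowup _), fun X' π hπ x' => ?_⟩
  obtain ⟨e, -, -⟩ := (affineBlowup.isBlowup _).unique hπ
  exact FTemkinClosedPoints.fullCl_of_isIso_stalkMap' 2 e.inv x' (affineBlowup_vertex_fullCl k f hf (e.inv.base x'))

end Summit.ResolutionOfSingularities.ResolutionOfSingularities.Theorems.FInjectiveMacaulayfication.E4GermPointBlowupFull

end
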